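import Summits.Ventures.QEC.Census.CertCoverChecks
import Summits.Ventures.QEC.Census.BB.BB288.CoverTables
import Summits.Ventures.QEC.Census.BB.BB288.CoverLogicals288
import HarnessLib

set_option Elab.async false

/-!
# `[[288,12,18]]` cover certificate — DATA 1c: kernel generator lists `D1`, `D2`, the augmented level-2→1 system `Hq2`, and
the generator tables of README §4 L-M (`kernelGensOK`, `annihilatesOK`, `coef72`), all decided.
-/

namespace Summit.Ventures.QEC.Census.BB288Cover

open Summit.Ventures.QEC.Census

/-- Generators of `ker H^X₁₄₄`: the 72 rows of `H^Z₁₄₄` then the 12 logicals. -/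
def D1 : List ℕ := bb144HZ ++ LZ144

/-- Generators of `ker H^X₇₂`: the 36 rows of `H^Z₇₂` then the 12 logicals. -/
def D2 : List ℕ := bb72HZ ++ LZ72

/-- The augmented level-2→1 system: `H^X₇₂` rows then the push-forwards `P₂ Lam2`. -/
def Hq2 : List ℕ := bb72HX ++ [0, 0, 0, 0, 0, 0]

/-- Selection words: `P₂ (P₁ LZ288_i) = xorSel bb72HZ coef72_i` (the images of the 288 logicals are 72-stabilizers). -/
def coef72 : List ℕ := [0, 0, 0, 0, 0, 0, 119276690, 153357750, 1125581939, 2167807029, 241961243, 132121746]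

/-- The push-forwards `P₁ LZ288_i` of the 12 logicals (DATA, checked by `pushedLZ_eq`; the `H^Z₂₈₈` rows push to `H^Z₁₄₄` rows by `rows_ok`). -/
def pushedLZ : List ℕ :=
  [
    306248897834254396, 612493466341474361, 90075497242034227,
    180146665157034023, 19599929461392281344, 39199581845854359104,
    12892072297772083199345492, 19338108041261727988320960, 425240406635430428478114279,
    818943737138603489969098663, 6347978982644193721063923, 12792902331414468605770880]

/-! ## Fast 144-bit parities (word-parallel popcount `popcR18`) -/

/-- Fast `H v = 0` over rows below `2^144`. (definition) -/
def synZ144 (H : List ℕ) (v : ℕ) : Bool := H.all fun h => popcR18 (h &&& v) % 2 == 0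

/-- `popcR18` is the bit count on words below `2^144` (`CertCheckBZFastP.popcR18_eq` + `popcFold_eq_popc`). -/
theorem popcR18_and_eq {a : ℕ} (ha : a < 2 ^ 144) (b : ℕ) : popcR18 (a &&& b) = popc 144 (a &&& b) := by
  rw [popcR18_eq]
  exact popcFold_eq_popc (by norm_num) (lt_of_le_of_lt Nat.and_le_left ha)

/-- The fast syndrome check agrees with `synZero 144` on rows below `2^144`. -/
theorem synZ144_eq {H : List ℕ} (hH : ∀ h ∈ H, h < 2 ^ 144) (v : ℕ) : synZ144 H v = synZero 144 H v := by
  induction H with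
  | nil => simp only [synZ144, synZero, List.all_nil]
  | cons h t ih =>
    have ih' := ih (fun x hx => hH x (List.mem_cons_of_mem _ hx))
    unfold synZ144 synZero at ih' ⊢
    rw [List.all_cons, List.all_cons, popcR18_and_eq (hH h List.mem_cons_self), ih']

/-! ## Generator tables from ROW tables (no push recomputation) -/

/-- If the rows of `H` push to rows of `Hq'` (row table) and every row of `Hq'` is a kernel word of `Hq`, then the
push-forward of every row of `H` is a kernel word of `Hq`. -/
theorem kernelGensOK_of_rows {c cr : Cover2} (hcr : cr.ok = true) {H Hq' Hq : List ℕ}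
    (hrows : pushRowsOK c cr H Hq' = true) (hk : (Hq'.all fun y => synZero c.nq Hq y) = true) :
    kernelGensOK c Hq H = true := by
  simp only [pushRowsOK, Bool.and_eq_true, List.all_eq_true, List.mem_range, beq_iff_eq] at hrows
  obtain ⟨⟨hn, hnq⟩, htab⟩ := hrows
  simp only [List.all_eq_true] at hk
  simp only [kernelGensOK, List.all_eq_true]
  intro x hx
  obtain ⟨r, hr, rfl⟩ := List.getElem_of_mem hx
  have e : H[r] = H.getD r 0 := by rw [List.getD_eq_getElem?_getD, List.getElem?_eq_getElem hr, Option.getD_some]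
  rw [e, htab r hr]
  have hq : cr.Q r < Hq'.length := hnq ▸ Cover2.Q_lt hcr (hn ▸ hr)
  refine hk _ ?_
  rw [List.getD_eq_getElem?_getD, List.getElem?_eq_getElem hq, Option.getD_some]; exact List.getElem_mem hq

/-- Same for the annihilation by functionals `Λ`. -/
theorem annihilatesOK_of_rows {c cr : Cover2} (hcr : cr.ok = true) {H Hq' Lam : List ℕ}
    (hrows : pushRowsOK c cr H Hq' = true)
    (ha : (Hq'.all fun y => Lam.all fun l => popc c.nq (l &&& y) % 2 == 0) = true) :
    annihilatesOK c Lam H = true := by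
  simp only [pushRowsOK, Bool.and_eq_true, List.all_eq_true, List.mem_range, beq_iff_eq] at hrows
  obtain ⟨⟨hn, hnq⟩, htab⟩ := hrows
  simp only [List.all_eq_true, beq_iff_eq] at ha
  simp only [annihilatesOK, List.all_eq_true, beq_iff_eq]
  intro x hx l hl
  obtain ⟨r, hr, rfl⟩ := List.getElem_of_mem hx
  have e : H[r] = H.getD r 0 := by rw [List.getD_eq_getElem?_getD, List.getElem?_eq_getElem hr, Option.getD_some]
  rw [e, htab r hr]
  have hq : cr.Q r < Hq'.length := hnq ▸ Cover2.Q_lt hcr (hn ▸ hr)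
  refine ha _ ?_ l hl
  rw [List.getD_eq_getElem?_getD, List.getElem?_eq_getElem hq, Option.getD_some]; exact List.getElem_mem hq

/-- `kernelGensOK` / `annihilatesOK` are conjunctive over concatenation. -/
theorem gensOK_append {c : Cover2} {Hq Lam A B : List ℕ} (h1 : kernelGensOK c Hq A = true)
    (h2 : kernelGensOK c Hq B = true) (h3 : annihilatesOK c Lam A = true) (h4 : annihilatesOK c Lam B = true) :
    kernelGensOK c Hq (A ++ B) = true ∧ annihilatesOK c Lam (A ++ B) = true := by
  simp only [kernelGensOK, annihilatesOK, List.all_append, Bool.and_eq_true] at *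
  exact ⟨⟨h1, h2⟩, h3, h4⟩

/-! ## Decided facts -/

/-- Rows of `H^X₁₄₄`, `H^Z₁₄₄` and the six functionals are below `2^144`. -/
theorem words144_lt : (bb144HX.all fun h => decide (h < 2 ^ 144)) = true ∧ (bb144HZ.all fun h => decide (h < 2 ^ 144)) = true ∧
    (Lam2.all fun h => decide (h < 2 ^ 144)) = true := by
  refine ⟨?_, ?_, ?_⟩ <;> decide +kernel

/-- Every generator of `ker H^X₁₄₄` in `D1` is a kernel word (once per level; feeds `cosetOK_of_cosetOKD`). -/
theorem D1_ker : (D1.all fun d => synZero 144 bb144HX d) = true := by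
  have hH : ∀ h ∈ bb144HX, h < 2 ^ 144 := by simpa [List.all_eq_true] using words144_lt.1
  have h : (D1.all fun d => synZ144 bb144HX d) = true := by decide +kernel
  simp only [List.all_eq_true] at h ⊢
  exact fun d hd => by rw [← synZ144_eq hH]; exact h d hd

/-- Every generator in `D2` is a kernel word of the AUGMENTED system `Hq2` (the six functionals vanish on `ker H^X₇₂`). -/
theorem D2_ker : (D2.all fun d => synZero 72 Hq2 d) = true := by decide +kernel

/-- The augmented system is `H^X₇₂ ++ Lam2.map P₂`. -/
theorem Hq2_eq : Hq2 = bb72HX ++ Lam2.map cov2.push := by decide +kernel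

/-- The 12 logical push-forwards are as tabulated. -/
theorem pushedLZ_eq : LZ288.map cov1.push = pushedLZ := by decide +kernel

/-- Fast facts on the `H^Z₁₄₄` rows and the pushed logicals: kernel words of `H^X₁₄₄`, annihilated by `Lam2`. -/
theorem gens1_fast : (bb144HZ.all fun y => synZ144 bb144HX y) = true ∧
    (bb144HZ.all fun y => Lam2.all fun l => popcR18 (l &&& y) % 2 == 0) = true ∧
    (pushedLZ.all fun y => synZ144 bb144HX y) = true ∧
    (pushedLZ.all fun y => Lam2.all fun l => popcR18 (l &&& y) % 2 == 0) = true := by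
  refine ⟨?_, ?_, ?_, ?_⟩ <;> decide +kernel

/-- L-M at level 1 (README §4): the push-forward of every generator of `ker H^X₂₈₈` (rows of `H^Z₂₈₈`, logicals
`LZ288`) is a kernel word of `H^X₁₄₄` annihilated by the six functionals `Lam2` (hypotheses of `push_of_gens`). -/
theorem gens1_ok : kernelGensOK cov1 bb144HX (bb288HZ ++ LZ288) = true ∧ annihilatesOK cov1 Lam2 (bb288HZ ++ LZ288) = true := by
  have hH : ∀ h ∈ bb144HX, h < 2 ^ 144 := by simpa [List.all_eq_true] using words144_lt.1
  have hL : ∀ l ∈ Lam2, l < 2 ^ 144 := by simpa [List.all_eq_true] using words144_lt.2.2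
  obtain ⟨f1, f2, f3, f4⟩ := gens1_fast
  -- slow forms on the H^Z₁₄₄ rows
  have k1 : (bb144HZ.all fun y => synZero 144 bb144HX y) = true := by
    simp only [List.all_eq_true] at f1 ⊢; exact fun y hy => by rw [← synZ144_eq hH]; exact f1 y hy
  have a1 : (bb144HZ.all fun y => Lam2.all fun l => popc 144 (l &&& y) % 2 == 0) = true := by
    simp only [List.all_eq_true, beq_iff_eq] at f2 ⊢
    exact fun y hy l hl => by rw [← popcR18_and_eq (hL l hl)]; exact f2 y hy l hl
  -- the logicals through the table
  have k2 : kernelGensOK cov1 bb144HX LZ288 = true := by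
    simp only [kernelGensOK, List.all_eq_true]
    intro x hx
    have hm : cov1.push x ∈ pushedLZ := by rw [← pushedLZ_eq]; exact List.mem_map.2 ⟨x, hx, rfl⟩
    simp only [List.all_eq_true] at f3
    show synZero 144 bb144HX (cov1.push x) = true
    rw [← synZ144_eq hH]; exact f3 _ hm
  have a2 : annihilatesOK cov1 Lam2 LZ288 = true := by
    simp only [annihilatesOK, List.all_eq_true, beq_iff_eq]
    intro x hx l hl
    have hm : cov1.push x ∈ pushedLZ := by rw [← pushedLZ_eq]; exact List.mem_map.2 ⟨x, hx, rfl⟩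
    simp only [List.all_eq_true, beq_iff_eq] at f4
    show popc 144 (l &&& cov1.push x) % 2 = 0
    rw [← popcR18_and_eq (hL l hl)]; exact f4 _ hm l hl
  exact gensOK_append (kernelGensOK_of_rows covs_ok.2.1 rows_ok.2.1 k1) k2 (annihilatesOK_of_rows covs_ok.2.1 rows_ok.2.1 a1) a2

/-- L-M at level 2: `P₂ (P₁ LZ288_i)` is the stated combination of `H^Z₇₂` rows (and `P₂ P₁` of an `H^Z₂₈₈` row is an
`H^Z₇₂` row by `rows_ok`), so `P₂ (P₁ v) ∈ rowspace H^Z₇₂` for every `v ∈ ker H^X₂₈₈`. -/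
theorem decomp72_ok : ((List.range 12).all fun i =>
    cov2.push (pushedLZ.getD i 0) == xorSel bb72HZ (coef72.getD i 0)) = true := by
  decide +kernel

end Summit.Ventures.QEC.Census.BB288Cover
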